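import Summits.QuantumFields.YangMills.Theorems.CurvatureBoostCovariance.Negative.Unbundled
import Summits.QuantumFields.YangMills.Theorems.NPointIsotropy.Negative.NPointRegularJunk
import Summits.QuantumFields.YangMills.Theorems.MirrorModularBoostsCurvatureBoostCovarianceRayPositivityCore
import Summits.QuantumFields.YangMills.Theorems.MirrorModularBoostsPlanarSpectralConeDensityHelpers
import Literature.MathematicalPhysics.QuantumFieldTheory.OSReconstructionNoE1
import Literature.Analysis.OperatorTheory.WeaklyHolomorphicFamily

/-!
# One link of the OS operator chain in a rotating frame — stub (T3, part A)

Line `Sketch` of crux `MirrorModularBoosts.SoftKernelBoostCovariance` (stmt-QuantumFields-14999).  Model-blind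
Osterwalder–Schrader bookkeeping over the `e₀`-reconstruction `h : OSReconstructionNoE1 S₁.toLabelled` of a
one-species Schwinger family `S₁` on `ℝ⁴` (`Literature/MathematicalPhysics/QuantumFieldTheory/OSReconstructionNoE1.lean`:
field vectors `h.fieldVec n k W hW = Ψ_W` of `e₀`-time-ordered test functions, `h.transfer t = e^{-tH}` translating
test functions by `t e₀` (`transfer_fieldVec`), `h.translate a = U(a⃗)` translating by the spatial part of `a`
(`translate_fieldVec`)).  Operator-valued twin of the pointwise chains of `…/OSBoostChains.lean` (Glimm–Jaffe
§19.5–19.7: continuation of Euclidean correlation functions in the ANGLE of a rotation of the `(x₀,x₁)`-plane by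
the OS operator calculus of the time axis).

**Statement** (`stub_bumpChainLink`).  Data: a CONE FAMILY `N : ℂ × ℂ → B(ℋ)` (`‖N p‖ ≤ 1` and weakly holomorphic
matrix elements on the planar tube `{|Im p.2| < Re p.1}`, `N(t,b) = e^{-tH}U(b e₁)` at real `t > 0`); a radial
one-point ITEM `f x = φ((x₀−(u+ρ))² + x₁²)·hh(x₂,x₃)` with `φ = 0` beyond `ρ²`, `2ρ ≤ u`; an INSERTION OPERATOR `B`
with `B Ψ_W = Ψ_{f ⊗ W_{(2u+v)e₀}}` on degree-`m` field vectors; a TAIL FAMILY `V'` holomorphic and bounded by `M` on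
the rectangle `{|Re ζ| < ε, |Im ζ| < R}`, `R > 0`, whose real values are the field vectors of the tail `Y` rotated by
`θ`, seen from the rotated centre `R_θ c` and pulled back by `(u+v−ρ)e₀`; the first gap
`γ(ζ) = (cos ζ Δ₁ + sin ζ Δ₂ − (w+u+ρ), −sin ζ Δ₁ + cos ζ Δ₂)`, `Δ = c − q`, stays in the tube on the rectangle.
Conclusion: `V ζ = N(γ ζ) B (V' ζ)` is holomorphic on the rectangle, `‖V ζ‖ ≤ ‖B‖ M` there, and for real `|θ| < ε`
and every `G` of degree `m + 1` which is pointwise (the rotated item centred at `R_θ c`) × (the rotated tail), both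
seen from `R_θ q` and pulled back by `w e₀`, `V θ = Ψ_G`.

**Proof.**
1. `gap_pos_of_tube`: at a real angle `θ` of the rectangle (`0 < R`) the tube hypothesis reads
   `t = cos θ Δ₁ + sin θ Δ₂ − (w+u+ρ) > 0`.
2. `tsupport_item_subset`, `isTimeOrdered_item_append`: the item has times in `[u, u+2ρ] ⊆ [u, 2u]`, so
   `f ⊗ W_{(2u+v)e₀}` is time-ordered for time-ordered `W` (`tsupport_appendTensor_subset`,
   `tsupport_translateMulti_subset`, `Fin.addCases`).
3. `link_differentiableOn_norm_le`: `γ` is entire and maps the rectangle into the tube, so `ζ ↦ N(γ ζ)` is bounded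
   by `1` with holomorphic matrix elements, hence norm-holomorphic by Dunford's theorem
   (`Literature.Analysis.OperatorTheory.differentiableOn_of_forall_differentiableOn_inner`; the rectangle is open,
   `isOpen_rect'`); `DifferentiableOn.clm_apply` with `ζ ↦ B (V' ζ)`; the bound is `‖N‖ ≤ 1`, `‖B x‖ ≤ ‖B‖‖x‖`.
4. `link_real`: at `ζ = θ` the argument of `N` is `(t, b)` with `t > 0` (`Complex.ofReal_cos/sin`), so
   `N(t,b) B (V' θ) = e^{-tH} U(b e₁) Ψ_{f ⊗ W_{(2u+v)e₀}}` (`hB` with step 2) is the field vector of the translate by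
   `t e₀ + b e₁` (`translate_fieldVec`, `transfer_fieldVec`), degree `1 + m`; the degree cast `fieldVec_congr_cast`
   (`subst`) reduces `= Ψ_G` to a pointwise identity which is pure translation bookkeeping (`appendTensor_apply`,
   `translateMulti_apply`, `linActMulti_apply`, coordinates of `timeVec`/`spatialPart`/`EuclideanSpace.single`, `ring`).

Remark: without `0 < R` the real angles need not lie in the rectangle, `t ≤ 0` is possible, `N(t,b)` is then
unconstrained and the real-value conclusion fails (e.g. for `Sₙ(F) = ∫F`, `R = 0`, `q = 0`, `w = 0`,
`c = (u/2 + ρ, 0)`).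

References: J. Glimm, A. Jaffe, *Quantum Physics* (2nd ed. 1987), §19.5–19.7; K. Osterwalder, R. Schrader, CMP 31
(1973) §4.1 (4.5)–(4.6); M. Reed, B. Simon, *Methods of Modern Mathematical Physics I*, Thm. VI.4.
-/

noncomputable section

namespace Summit.QuantumFields.YangMills.Theorems.SoftKernelBoostCovariance.Sketch

open scoped InnerProductSpace SchwartzMap
open Literature.MathematicalPhysics.QuantumLattice Literature.MathematicalPhysics.AQFT
  Literature.MathematicalPhysics.QuantumFieldTheory
open Summit.QuantumFields.YangMills.Theorems.NPointIsotropy.Negative (E4)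

/-! ## Geometry of the rectangle and the tube -/

/-- The rectangle `{|Re ζ| < ε ∧ |Im ζ| < R}` is open. -/
theorem isOpen_rect' (ε R : ℝ) : IsOpen {ζ : ℂ | |ζ.re| < ε ∧ |ζ.im| < R} :=
  (isOpen_lt (continuous_abs.comp Complex.continuous_re) continuous_const).and
    (isOpen_lt (continuous_abs.comp Complex.continuous_im) continuous_const)

/-- **The tube hypothesis at a real angle**: the reserved time gap is positive,
`r < (R_θ Δ)₀ = cos θ · Δ₁ + sin θ · Δ₂`. -/
theorem gap_pos_of_tube {ε R r : ℝ} {Δ₁ Δ₂ : ℝ} (hR : 0 < R)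
    (htube : ∀ ζ : ℂ, |ζ.re| < ε → |ζ.im| < R →
      |(-Complex.sin ζ * Δ₁ + Complex.cos ζ * Δ₂).im| < (Complex.cos ζ * Δ₁ + Complex.sin ζ * Δ₂).re - r)
    {θ : ℝ} (hθ : |θ| < ε) : r < Real.cos θ * Δ₁ + Real.sin θ * Δ₂ := by
  have h1 := htube θ (by simpa using hθ) (by simpa using hR)
  have e2 : Complex.cos ↑θ * ↑Δ₁ + Complex.sin ↑θ * ↑Δ₂ = ((Real.cos θ * Δ₁ + Real.sin θ * Δ₂ : ℝ) : ℂ) := by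
    push_cast; ring
  rw [e2, Complex.ofReal_re] at h1
  linarith [abs_nonneg ((-Complex.sin ↑θ * ↑Δ₁ + Complex.cos ↑θ * ↑Δ₂).im)]

variable {S₁ : SchwingerFamily E4}

/-- **Degree cast for field vectors**: field vectors of test functions of degrees `n = n'` that agree after
reindexing along `Fin.cast` coincide (`subst`; used with `1 + m = m + 1`). -/
theorem fieldVec_congr_cast (h : OSReconstructionNoE1 S₁.toLabelled) {n n' : ℕ} (e : n = n')
    {F : 𝓢((Fin n → E4), ℂ)} {G : 𝓢((Fin n' → E4), ℂ)} (hF : IsTimeOrdered F) (hG : IsTimeOrdered G)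
    (hFG : ∀ x, G x = F (fun i => x (Fin.cast e i))) :
    h.fieldVec n (fun _ => ()) F hF = h.fieldVec n' (fun _ => ()) G hG := by
  subst e
  have hFG' : F = G := by
    ext x
    exact (hFG x).symm
  subst hFG'
  rfl

/-! ## Radial items: support and time-ordering -/

/-- **Support of a radial item**: planar distance at most `ρ` from the centre `(u + ρ, 0)`, hence times in
`[u, u + 2ρ]`. -/
theorem tsupport_item_subset {u ρ : ℝ} (φ : ℝ → ℂ) (hh : ℝ × ℝ → ℂ) (f : 𝓢((Fin 1 → E4), ℂ))
    (hρ : 0 < ρ) (hφ : ∀ r, ρ ^ 2 < r → φ r = 0)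
    (hf : ∀ x, f x = φ ((x 0 0 - (u + ρ)) ^ 2 + (x 0 1) ^ 2) * hh (x 0 2, x 0 3)) :
    tsupport (f : (Fin 1 → E4) → ℂ) ⊆ {y | |y 0 0 - (u + ρ)| ≤ ρ} := by
  refine closure_minimal (fun y hy => ?_) (isClosed_le (by fun_prop) continuous_const)
  rw [Function.mem_support, hf] at hy
  have h1 : φ ((y 0 0 - (u + ρ)) ^ 2 + (y 0 1) ^ 2) ≠ 0 := left_ne_zero_of_mul hy
  have h2 : (y 0 0 - (u + ρ)) ^ 2 + (y 0 1) ^ 2 ≤ ρ ^ 2 := not_lt.1 fun h' => h1 (hφ _ h')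
  rw [Set.mem_setOf_eq]
  exact abs_le_of_sq_le_sq (by nlinarith [sq_nonneg (y 0 1)]) hρ.le

/-- **Prepending a radial item keeps time-ordering**: the item's times lie in `[u, u + 2ρ] ⊆ [u, 2u]`, the
`(2u+v)e₀`-translate of a time-ordered tail has strictly increasing times `> 2u + v`. -/
theorem isTimeOrdered_item_append {m : ℕ} {u v ρ : ℝ} (φ : ℝ → ℂ) (hh : ℝ × ℝ → ℂ)
    (f : 𝓢((Fin 1 → E4), ℂ)) (hv : 0 < v) (hρ : 0 < ρ) (h2ρ : 2 * ρ ≤ u)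
    (hφ : ∀ r, ρ ^ 2 < r → φ r = 0)
    (hf : ∀ x, f x = φ ((x 0 0 - (u + ρ)) ^ 2 + (x 0 1) ^ 2) * hh (x 0 2, x 0 3))
    {W : 𝓢((Fin m → E4), ℂ)} (hW : IsTimeOrdered W) :
    IsTimeOrdered (SchwartzMap.appendTensor f
      (translateMulti ((2 * u + v) • EuclideanSpace.single 0 1) W)) := by
  intro x hx
  obtain ⟨hA, hB⟩ := OSReconstructionNoE1.tsupport_appendTensor_subset _ _ hx
  have h0 : |x (Fin.castAdd m 0) 0 - (u + ρ)| ≤ ρ := tsupport_item_subset φ hh f hρ hφ hf hA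
  have h0' := abs_le.1 h0
  have hB' := hW (OSReconstructionNoE1.tsupport_translateMulti_subset _ W hB)
  simp only [Set.mem_setOf_eq, PiLp.sub_apply, PiLp.smul_apply, PiLp.single_apply, if_true,
    smul_eq_mul, mul_one, sub_pos] at hB'
  obtain ⟨htail, hmono⟩ := hB'
  have hlt : ∀ j, x (Fin.castAdd m 0) 0 < x (Fin.natAdd 1 j) 0 := fun j => by
    have := htail j
    linarith
  refine ⟨fun i => ?_, fun i j hij => ?_⟩
  · induction i using Fin.addCases with
    | left i0 =>
      rw [Subsingleton.elim i0 0]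
      linarith
    | right j =>
      have := htail j
      linarith
  · induction i using Fin.addCases with
    | left i0 =>
      induction j using Fin.addCases with
      | left j0 =>
        rw [Subsingleton.elim i0 0, Subsingleton.elim j0 0] at hij
        exact absurd hij (lt_irrefl _)
      | right j' =>
        rw [Subsingleton.elim i0 0]
        exact hlt j'
    | right i' =>
      induction j using Fin.addCases with
      | left j0 =>
        exfalso
        rw [Fin.lt_def] at hij
        simp at hij
      | right j' =>
        have hij' : i' < j' := by
          rw [Fin.lt_def] at hij ⊢
          simpa using hij
        have := hmono hij'
        simpa using this

/-! ## One link: holomorphy, bound, real values -/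

/-- **One link — holomorphy and bound.**  For a cone family `N` (norm `≤ 1` on the planar tube, weakly
holomorphic there), a bounded `B`, and `V'` holomorphic and bounded by `M` on the rectangle, the family
`ζ ↦ N(cos ζ Δ₁ + sin ζ Δ₂ − s, −sin ζ Δ₁ + cos ζ Δ₂) B (V' ζ)` is holomorphic on the rectangle when the curve stays in
the tube there (Dunford: weak + bounded ⇒ norm-holomorphic, `differentiableOn_of_forall_differentiableOn_inner`;
then `DifferentiableOn.clm_apply`), and is bounded by `‖B‖ M`. -/
theorem link_differentiableOn_norm_le (h : OSReconstructionNoE1 S₁.toLabelled)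
    (N : ℂ × ℂ → (h.Hilbert →L[ℂ] h.Hilbert))
    (hN1 : ∀ p : ℂ × ℂ, |p.2.im| < p.1.re → ‖N p‖ ≤ 1)
    (hN2 : ∀ ψ ψ' : h.Hilbert, DifferentiableOn ℂ (fun p : ℂ × ℂ => ⟪ψ, N p ψ'⟫_ℂ)
      {p : ℂ × ℂ | |p.2.im| < p.1.re})
    (Δ₁ Δ₂ : ℂ) (s ε R M : ℝ) (B : h.Hilbert →L[ℂ] h.Hilbert) (V' : ℂ → h.Hilbert)
    (hV'd : DifferentiableOn ℂ V' {ζ : ℂ | |ζ.re| < ε ∧ |ζ.im| < R})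
    (hV'b : ∀ ζ : ℂ, |ζ.re| < ε → |ζ.im| < R → ‖V' ζ‖ ≤ M)
    (htube : ∀ ζ : ℂ, |ζ.re| < ε → |ζ.im| < R →
      |(-Complex.sin ζ * Δ₁ + Complex.cos ζ * Δ₂).im| <
        (Complex.cos ζ * Δ₁ + Complex.sin ζ * Δ₂).re - s) :
    DifferentiableOn ℂ (fun ζ : ℂ =>
        N (Complex.cos ζ * Δ₁ + Complex.sin ζ * Δ₂ - (s : ℂ), -Complex.sin ζ * Δ₁ + Complex.cos ζ * Δ₂)
          (B (V' ζ))) {ζ : ℂ | |ζ.re| < ε ∧ |ζ.im| < R} ∧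
    (∀ ζ : ℂ, |ζ.re| < ε → |ζ.im| < R →
      ‖N (Complex.cos ζ * Δ₁ + Complex.sin ζ * Δ₂ - (s : ℂ), -Complex.sin ζ * Δ₁ + Complex.cos ζ * Δ₂)
          (B (V' ζ))‖ ≤ ‖B‖ * M) := by
  set U : Set ℂ := {ζ : ℂ | |ζ.re| < ε ∧ |ζ.im| < R} with hU
  set γ : ℂ → ℂ × ℂ := fun ζ =>
    (Complex.cos ζ * Δ₁ + Complex.sin ζ * Δ₂ - (s : ℂ), -Complex.sin ζ * Δ₁ + Complex.cos ζ * Δ₂) with hγ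
  have hγd : Differentiable ℂ γ := by
    rw [hγ]
    fun_prop
  have hγU : ∀ ζ ∈ U, |(γ ζ).2.im| < (γ ζ).1.re := by
    intro ζ hζ
    have h1 := htube ζ hζ.1 hζ.2
    simp only [hγ, Complex.sub_re, Complex.ofReal_re]
    exact h1
  have hNγ : DifferentiableOn ℂ (fun ζ => N (γ ζ)) U :=
    Literature.Analysis.OperatorTheory.differentiableOn_of_forall_differentiableOn_inner
      (isOpen_rect' ε R) (fun z hz => hN1 _ (hγU z hz))
      (fun a b => (hN2 a b).comp hγd.differentiableOn hγU)
  have hBV : DifferentiableOn ℂ (fun ζ => B (V' ζ)) U := B.differentiable.comp_differentiableOn hV'd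
  refine ⟨?_, fun ζ h1 h2 => ?_⟩
  · have := hNγ.clm_apply hBV
    simpa only [hγ] using this
  · have hζ : ζ ∈ U := ⟨h1, h2⟩
    calc ‖N (γ ζ) (B (V' ζ))‖ ≤ ‖N (γ ζ)‖ * ‖B (V' ζ)‖ := (N (γ ζ)).le_opNorm _
      _ ≤ 1 * (‖B‖ * M) := by
          refine mul_le_mul (hN1 _ (hγU ζ hζ)) ((B.le_opNorm _).trans ?_) (norm_nonneg _) zero_le_one
          exact mul_le_mul_of_nonneg_left (hV'b ζ h1 h2) (norm_nonneg _)
      _ = ‖B‖ * M := one_mul _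

/-- **One link — real values.**  At a real angle `θ` with positive reserved first gap
`t = (R_θ(c−q))₀ − (w+u+ρ) > 0`: `N(t, b) B (V' θ) = e^{-tH} U(b e₁) Ψ_{f ⊗ W_{(2u+v)e₀}}` (`W` the tail seen from the
rotating centre; `hB`, `N(t,b) = e^{-tH}U(be₁)`, `translate_fieldVec`, `transfer_fieldVec`) is the field vector of a
translate of `f ⊗ W_{(2u+v)e₀}` (degree `1 + m`), which after the degree cast `1 + m = m + 1` is pointwise the given
`G` — pure translation bookkeeping (the tail is already rotated; the item's translations add up). -/
theorem link_real (h : OSReconstructionNoE1 S₁.toLabelled) (N : ℂ × ℂ → (h.Hilbert →L[ℂ] h.Hilbert))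
    (hN3 : ∀ (t b : ℝ), 0 < t → ∀ ψ : h.Hilbert,
      N ((t : ℂ), (b : ℂ)) ψ = h.transfer t (h.translate (b • EuclideanSpace.single 1 1) ψ))
    (m : ℕ) (u v ρ w : ℝ) (φ : ℝ → ℂ) (hh : ℝ × ℝ → ℂ) (f : 𝓢((Fin 1 → E4), ℂ))
    (B : h.Hilbert →L[ℂ] h.Hilbert) (Y : 𝓢((Fin m → E4), ℂ)) (c q : ℝ × ℝ) (V' : ℂ → h.Hilbert)
    (hv : 0 < v) (hρ : 0 < ρ) (h2ρ : 2 * ρ ≤ u)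
    (hφ : ∀ r : ℝ, ρ ^ 2 < r → φ r = 0)
    (hf : ∀ x : Fin 1 → E4, f x = φ ((x 0 0 - (u + ρ)) ^ 2 + (x 0 1) ^ 2) * hh (x 0 2, x 0 3))
    (hB : ∀ (W : 𝓢((Fin m → E4), ℂ)) (hW : IsTimeOrdered W)
      (hFW : IsTimeOrdered (SchwartzMap.appendTensor f
        (translateMulti ((2 * u + v) • EuclideanSpace.single 0 1) W))),
      B (h.fieldVec m (fun _ => ()) W hW) =
        h.fieldVec (1 + m) (fun _ => ()) (SchwartzMap.appendTensor f
          (translateMulti ((2 * u + v) • EuclideanSpace.single 0 1) W)) hFW)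
    (θ : ℝ)
    (hV'r : ∃ hθ : IsTimeOrdered (translateMulti
          (-((Real.cos θ * c.1 + Real.sin θ * c.2 + (u + v - ρ)) • EuclideanSpace.single 0 1 +
            (-Real.sin θ * c.1 + Real.cos θ * c.2) • EuclideanSpace.single 1 1))
          (linActMulti (planeRot (0 : Fin 3) θ) Y)),
        V' θ = h.fieldVec m (fun _ => ()) (translateMulti
          (-((Real.cos θ * c.1 + Real.sin θ * c.2 + (u + v - ρ)) • EuclideanSpace.single 0 1 +
            (-Real.sin θ * c.1 + Real.cos θ * c.2) • EuclideanSpace.single 1 1))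
          (linActMulti (planeRot (0 : Fin 3) θ) Y)) hθ)
    (ht : 0 < Real.cos θ * (c.1 - q.1) + Real.sin θ * (c.2 - q.2) - (w + u + ρ))
    (G : 𝓢((Fin (m + 1) → E4), ℂ))
    (hG : ∀ x : Fin (m + 1) → E4, G x =
      (φ ((x 0 0 + (Real.cos θ * q.1 + Real.sin θ * q.2 + w) - (Real.cos θ * c.1 + Real.sin θ * c.2)) ^ 2 +
            (x 0 1 + (-Real.sin θ * q.1 + Real.cos θ * q.2) - (-Real.sin θ * c.1 + Real.cos θ * c.2)) ^ 2) *
          hh (x 0 2, x 0 3)) *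
        (translateMulti
          (-((Real.cos θ * q.1 + Real.sin θ * q.2 + w) • EuclideanSpace.single 0 1 +
            (-Real.sin θ * q.1 + Real.cos θ * q.2) • EuclideanSpace.single 1 1))
          (linActMulti (planeRot (0 : Fin 3) θ) Y)) (Fin.tail x))
    (hGt : IsTimeOrdered G) :
    N (Complex.cos θ * (c.1 - q.1) + Complex.sin θ * (c.2 - q.2) - ((w + u + ρ : ℝ) : ℂ),
        -Complex.sin θ * (c.1 - q.1) + Complex.cos θ * (c.2 - q.2)) (B (V' θ)) =
      h.fieldVec (m + 1) (fun _ => ()) G hGt := by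
  obtain ⟨hθ', hV'θ⟩ := hV'r
  set W := translateMulti
    (-((Real.cos θ * c.1 + Real.sin θ * c.2 + (u + v - ρ)) • EuclideanSpace.single 0 1 +
      (-Real.sin θ * c.1 + Real.cos θ * c.2) • EuclideanSpace.single 1 1))
    (linActMulti (planeRot (0 : Fin 3) θ) Y) with hWdef
  set t : ℝ := Real.cos θ * (c.1 - q.1) + Real.sin θ * (c.2 - q.2) - (w + u + ρ) with htdef
  set b : ℝ := -Real.sin θ * (c.1 - q.1) + Real.cos θ * (c.2 - q.2) with hbdef
  have hpair : (Complex.cos θ * (c.1 - q.1) + Complex.sin θ * (c.2 - q.2) - ((w + u + ρ : ℝ) : ℂ),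
      -Complex.sin θ * (c.1 - q.1) + Complex.cos θ * (c.2 - q.2)) = ((t : ℂ), (b : ℂ)) := by
    rw [htdef, hbdef]
    push_cast
    ring_nf
  have hFW := isTimeOrdered_item_append (m := m) φ hh f hv hρ h2ρ hφ hf hθ'
  rw [hpair, hV'θ, hB W hθ' hFW, hN3 t b ht, h.translate_fieldVec, h.transfer_fieldVec ht.le]
  refine fieldVec_congr_cast h (Nat.add_comm 1 m) _ hGt fun x => ?_
  rw [hG x]
  simp only [hWdef, translateMulti_apply, linActMulti_apply, SchwartzMap.appendTensor_apply,
    Function.comp_def, hf]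
  have hidx0 : Fin.cast (Nat.add_comm 1 m) (Fin.castAdd m 0) = 0 := Fin.ext rfl
  have hidx : ∀ i : Fin m, Fin.cast (Nat.add_comm 1 m) (Fin.natAdd 1 i) = i.succ := fun i =>
    Fin.ext (by simp)
  simp only [hidx0, hidx]
  congr 1
  · congr 1
    · congr 1
      simp [PiLp.sub_apply, PiLp.smul_apply, spatialPart_apply, SchwingerFamily.timeVec, htdef, hbdef]
      ring
    · simp [PiLp.sub_apply, PiLp.smul_apply, spatialPart_apply, SchwingerFamily.timeVec]
  · congr 1
    funext i
    congr 1
    ext k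
    fin_cases k <;>
      simp [PiLp.sub_apply, PiLp.add_apply, PiLp.neg_apply, PiLp.smul_apply,
        spatialPart_apply, SchwingerFamily.timeVec, htdef, hbdef, Fin.tail] <;> ring

/-! ## The stub -/

/-- **Stub (T3, part A) — ONE LINK OF THE OPERATOR CHAIN** (model-blind OS bookkeeping over the
`e₀`-reconstruction).  For a cone family `N`, a radial item `f` centred at `(u+ρ, 0)`, an insertion operator `B` and
a tail family `V'` (holomorphic, bounded by `M` on the rectangle `{|Re ζ| < ε, |Im ζ| < R}`, `R > 0`, real values =
field vectors of the rotated tail seen from the rotating centre), the family `ζ ↦ N(R_ζ(c−q) − (w+u+ρ)e₀) B (V' ζ)` is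
holomorphic on the rectangle (`link_differentiableOn_norm_le`: Dunford + `clm_apply`), bounded by `‖B‖ M`, and at
real angles equals the field vector of the whole rotated configuration (`link_real`: `N(t,b) = e^{-tH}U(be₁)`,
`translate_fieldVec`, `transfer_fieldVec`, degree cast `1 + m = m + 1`, translation bookkeeping). -/
theorem stub_bumpChainLink :
    open Literature.MathematicalPhysics.QuantumLattice Literature.MathematicalPhysics.AQFT
      Literature.MathematicalPhysics.QuantumFieldTheory
      Summit.QuantumFields.YangMills.Theorems.CurvatureBoostCovariance.Negative
      Summit.QuantumFields.YangMills.Theorems.NPointIsotropy.Negative in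
    (∀ (S₁ : SchwingerFamily E4) (h : OSReconstructionNoE1 S₁.toLabelled)
      (N : ℂ × ℂ → (h.Hilbert →L[ℂ] h.Hilbert)),
      (∀ p : ℂ × ℂ, |p.2.im| < p.1.re → ‖N p‖ ≤ 1) →
      (∀ ψ ψ' : h.Hilbert, DifferentiableOn ℂ (fun p : ℂ × ℂ => ⟪ψ, N p ψ'⟫_ℂ) {p : ℂ × ℂ | |p.2.im| < p.1.re}) →
      (∀ (t b : ℝ), 0 < t → ∀ ψ : h.Hilbert,
        N ((t : ℂ), (b : ℂ)) ψ = h.transfer t (h.translate (b • EuclideanSpace.single 1 1) ψ)) →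
      ∀ (m : ℕ) (u v ρ w ε R M : ℝ) (φ : ℝ → ℂ) (hh : ℝ × ℝ → ℂ) (f : SchwartzMap (Fin 1 → E4) ℂ)
        (B : h.Hilbert →L[ℂ] h.Hilbert) (Y : SchwartzMap (Fin m → E4) ℂ) (c q : ℝ × ℝ) (V' : ℂ → h.Hilbert),
        0 < u → 0 < v → 0 < ρ → 2 * ρ ≤ u → 0 ≤ w → 0 < R →
        (∀ r : ℝ, ρ ^ 2 < r → φ r = 0) →
        (∀ x : Fin 1 → E4, f x = φ ((x 0 0 - (u + ρ)) ^ 2 + (x 0 1) ^ 2) * hh (x 0 2, x 0 3)) →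
        (∀ (W : SchwartzMap (Fin m → E4) ℂ) (hW : IsTimeOrdered W)
          (hFW : IsTimeOrdered (SchwartzMap.appendTensor f
            (translateMulti ((2 * u + v) • EuclideanSpace.single 0 1) W))),
          B (h.fieldVec m (fun _ => ()) W hW) =
            h.fieldVec (1 + m) (fun _ => ()) (SchwartzMap.appendTensor f
              (translateMulti ((2 * u + v) • EuclideanSpace.single 0 1) W)) hFW) →
        DifferentiableOn ℂ V' {ζ : ℂ | |ζ.re| < ε ∧ |ζ.im| < R} →
        (∀ ζ : ℂ, |ζ.re| < ε → |ζ.im| < R → ‖V' ζ‖ ≤ M) →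
        (∀ θ : ℝ, |θ| < ε →
          ∃ hθ : IsTimeOrdered (translateMulti
                (-((Real.cos θ * c.1 + Real.sin θ * c.2 + (u + v - ρ)) • EuclideanSpace.single 0 1 +
                  (-Real.sin θ * c.1 + Real.cos θ * c.2) • EuclideanSpace.single 1 1))
                (linActMulti (planeRot (0 : Fin 3) θ) Y)),
            V' θ = h.fieldVec m (fun _ => ()) (translateMulti
                  (-((Real.cos θ * c.1 + Real.sin θ * c.2 + (u + v - ρ)) • EuclideanSpace.single 0 1 +
                    (-Real.sin θ * c.1 + Real.cos θ * c.2) • EuclideanSpace.single 1 1))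
                  (linActMulti (planeRot (0 : Fin 3) θ) Y)) hθ) →
        (∀ ζ : ℂ, |ζ.re| < ε → |ζ.im| < R →
          |(-Complex.sin ζ * (c.1 - q.1) + Complex.cos ζ * (c.2 - q.2)).im| <
            (Complex.cos ζ * (c.1 - q.1) + Complex.sin ζ * (c.2 - q.2)).re - (w + u + ρ)) →
        DifferentiableOn ℂ (fun ζ : ℂ =>
            N (Complex.cos ζ * (c.1 - q.1) + Complex.sin ζ * (c.2 - q.2) - ((w + u + ρ : ℝ) : ℂ),
               -Complex.sin ζ * (c.1 - q.1) + Complex.cos ζ * (c.2 - q.2)) (B (V' ζ)))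
          {ζ : ℂ | |ζ.re| < ε ∧ |ζ.im| < R} ∧
        (∀ ζ : ℂ, |ζ.re| < ε → |ζ.im| < R →
          ‖N (Complex.cos ζ * (c.1 - q.1) + Complex.sin ζ * (c.2 - q.2) - ((w + u + ρ : ℝ) : ℂ),
               -Complex.sin ζ * (c.1 - q.1) + Complex.cos ζ * (c.2 - q.2)) (B (V' ζ))‖ ≤ ‖B‖ * M) ∧
        (∀ θ : ℝ, |θ| < ε → ∀ (G : SchwartzMap (Fin (m + 1) → E4) ℂ),
          (∀ x : Fin (m + 1) → E4, G x =
            (φ ((x 0 0 + (Real.cos θ * q.1 + Real.sin θ * q.2 + w) - (Real.cos θ * c.1 + Real.sin θ * c.2)) ^ 2 +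
                 (x 0 1 + (-Real.sin θ * q.1 + Real.cos θ * q.2) - (-Real.sin θ * c.1 + Real.cos θ * c.2)) ^ 2) *
               hh (x 0 2, x 0 3)) *
            (translateMulti
                (-((Real.cos θ * q.1 + Real.sin θ * q.2 + w) • EuclideanSpace.single 0 1 +
                  (-Real.sin θ * q.1 + Real.cos θ * q.2) • EuclideanSpace.single 1 1))
                (linActMulti (planeRot (0 : Fin 3) θ) Y)) (Fin.tail x)) →
          ∀ hG : IsTimeOrdered G,
            N (Complex.cos θ * (c.1 - q.1) + Complex.sin θ * (c.2 - q.2) - ((w + u + ρ : ℝ) : ℂ),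
               -Complex.sin θ * (c.1 - q.1) + Complex.cos θ * (c.2 - q.2)) (B (V' θ)) =
              h.fieldVec (m + 1) (fun _ => ()) G hG))
    := by
  intro S₁ h N hN1 hN2 hN3 m u v ρ w ε R M φ hh f B Y c q V' _hu hv hρ h2ρ _hw hR hφ hf hB hV'd hV'b hV'r htube
  obtain ⟨hD, hbd⟩ := link_differentiableOn_norm_le h N hN1 hN2 (c.1 - q.1) (c.2 - q.2) (w + u + ρ) ε R M B V'
    hV'd hV'b htube
  refine ⟨hD, hbd, fun θ hθ G hG hGt => ?_⟩
  have ht : 0 < Real.cos θ * (c.1 - q.1) + Real.sin θ * (c.2 - q.2) - (w + u + ρ) := by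
    have := gap_pos_of_tube hR (fun ζ h1 h2 => by exact_mod_cast htube ζ h1 h2) hθ
    linarith
  exact link_real h N hN3 m u v ρ w φ hh f B Y c q V' hv hρ h2ρ hφ hf hB θ (hV'r θ hθ) ht G hG hGt

end Summit.QuantumFields.YangMills.Theorems.SoftKernelBoostCovariance.Sketch

end
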